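import Literature.AlgebraicGeometry.Resolution.Lipman1969RationalSurfaceSingularities
import Literature.AlgebraicGeometry.Resolution.ProperBirationalGlobalSections
import Literature.AlgebraicGeometry.Resolution.ResolutionFibreDimension
import Literature.AlgebraicGeometry.Motives.CartierDivisorEffective
import Mathlib.RingTheory.Ideal.KrullsHeightTheorem
import HarnessLib

/-!
# Crux `NoZenoR` (stmt-ResolutionOfSingularities-19943), slot `stub_L1wCoreF`, (B1) split core upstairs:
# an effective exceptional Cartier divisor has a NONZERO intersection number with some exceptional curve

Route `ResolutionOfSingularities/HomologicalConductor`.  OURS (cell res-hironaka, crux chain W4.4, lead seat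
res-L0-w44-lead-1 g8); nothing here is a statement of the manuscript under review (Hironaka 2017); AI-written,
weaker than expert review.  Helper for the registered stub `stub_L1wCoreF` of the crux skeleton (HOME
`L/res-L0-w44-lead-1/NoZeno-v32.lean`): brick UP-1 of res-L0-w44-stub-2's (L1)-PREP v2 §3.3 («negative
definiteness, Lipman (14.1)-lite»), in the WEAKER form that STEP 3 (1) of the (B1) split core actually consumes
— «the set `P = {E : (Z·E) < 0}` of the anti-nef cycle `Z` with `I·𝒪_(X¹) = 𝒪(−Z)` is non-empty» — and proved
WITHOUT any intersection matrix, from the already-bundled named fact Lipman 1969 (12.1) (i).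

## Statement

`exists_excCurveDegree_ne_zero`: let `T` be a Noetherian local normal domain of Krull dimension `≥ 2`,
`π : X → Spec T` a resolution (proper, birational, `X` regular) with fibres of dimension `≤ 1` and
`H¹(X, 𝒪_X) = 0` (`HasTrivialCechH1`), and `D` an EFFECTIVE Cartier divisor on `X` whose local equations are
units at every point off the closed fibre and NOT a unit at some point.  Then, granting `Lipman1969_12_1_i`,
some integral exceptional curve `E_η` has `(𝒪_X(D) · E_η) ≠ 0`.  Corollaries: the anti-nef sign version
(`exists_excCurveDegree_neg_of_antinef`: all `(D·E) ≤ 0` ⇒ some `(D·E) < 0`) and the two-dimensional case with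
the fibre hypothesis discharged from the tree (`exists_excCurveDegree_ne_zero_of_ringKrullDim_eq_two`), and the
same in support language (`CartierDivisor.Avoids`: `…_of_supp`, `…_of_supp_of_ringKrullDim_eq_two`).

## Proof

If every `(𝒪_X(D) · E_η)` vanished, (12.1) (i) would give a nowhere-vanishing global section `s` of `𝒪_X(D)`:
`f_i · s ∈ 𝒪_(X,x)^×` on `U_i`.  Then `t := s⁻¹ = f_i · (f_i s)⁻¹` is regular everywhere (`D ≥ 0`), a unit off
the closed fibre, and a non-unit at the given point `x₀`.  By `H⁰(X, 𝒪_X) = T`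
(`IsResolution.exists_baseToFunctionField_eq_of_forall_isRegularAt`) `t` is an element `a ∈ T`, and `a ∈ 𝔪_T`
(`isUnitAt_baseToFunctionField_iff`: `a` is a unit at `x` iff `a ∉ π(x)`).  Krull's principal ideal theorem and
`dim T ≥ 2` put `a` in a prime `𝔭 ≠ 𝔪_T` (`exists_prime_mem_ne_maximalIdeal`); `π` is surjective (proper and
dominant), so some `x₁ ∈ X` lies over `𝔭`, where `a` is simultaneously a non-unit (`a ∈ 𝔭`) and a unit
(`x₁` is off the closed fibre) — contradiction.

References: J. Lipman, *Rational singularities …*, Publ. Math. IHÉS 36 (1969), Thm. (12.1) (i) (p. 220)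
[`Lipman1969`]; res-L0-w44-stub-2, (L1)-PREP v2 §2/§3.3 (OURS, 2026-08-27).
-/

noncomputable section

-- single-problem summit: the doubled namespace component `ResolutionOfSingularities` is forced
set_option linter.dupNamespace false

namespace Summit.ResolutionOfSingularities.ResolutionOfSingularities.Theorems.NoZeno.ExcCount

open CategoryTheory AlgebraicGeometry TopologicalSpace IsLocalRing
open Literature.AlgebraicGeometry.Resolution Literature.AlgebraicGeometry.Motives
open Literature.AlgebraicGeometry.Motives.RatFn

universe u

/-! ## §0 Algebra: in dimension `≥ 2` a non-unit lies in a non-maximal prime -/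

/-- **Krull**: in a Noetherian local ring of Krull dimension `≥ 2`, every element of the maximal ideal lies in
a prime ideal other than the maximal ideal (a minimal prime over `(a)` has height `≤ 1 < 2 = ht 𝔪`).
[folklore] -/
theorem exists_prime_mem_ne_maximalIdeal {T : Type u} [CommRing T] [IsNoetherianRing T] [IsLocalRing T]
    (hdim : 2 ≤ ringKrullDim T) {a : T} (ha : a ∈ maximalIdeal T) :
    ∃ 𝔭 : Ideal T, 𝔭.IsPrime ∧ a ∈ 𝔭 ∧ 𝔭 ≠ maximalIdeal T := by
  have hne : Ideal.span {a} ≠ ⊤ := by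
    rw [Ne, Ideal.span_singleton_eq_top]
    exact ha
  obtain ⟨⟨𝔭, h𝔭⟩⟩ := Ideal.nonempty_minimalPrimes hne
  have hht : 𝔭.height ≤ 1 := Ideal.height_le_one_of_isPrincipal_of_mem_minimalPrimes _ 𝔭 h𝔭
  refine ⟨𝔭, h𝔭.1.1, h𝔭.1.2 (Ideal.mem_span_singleton_self a), ?_⟩
  rintro rfl
  have hm := IsLocalRing.maximalIdeal_height_eq_ringKrullDim (R := T)
  have h2 : (2 : WithBot ℕ∞) ≤ (1 : ℕ∞) := by
    calc (2 : WithBot ℕ∞) ≤ ringKrullDim T := hdim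
      _ = ((maximalIdeal T).height : WithBot ℕ∞) := hm.symm
      _ ≤ (1 : ℕ∞) := WithBot.coe_le_coe.mpr hht
  exact absurd h2 (by decide)

/-! ## §1 The structure map `T → K(X)`: units and surjectivity -/

section Base

variable {T : Type u} [CommRing T] {X : Scheme.{u}} [IsIntegral X] (π : X ⟶ Spec (.of T))

/-- **Unit criterion for base functions**: `a ∈ T`, read as a rational function on `X` via
`baseToFunctionField π`, is a unit at `x ∈ X` iff `a ∉ π(x)` (the germ of the global section `a` at `x` is a
unit iff `x` lies in the basic open `X_a = π⁻¹ D(a)`). [folklore] -/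
theorem isUnitAt_baseToFunctionField_iff (x : X) (a : T) :
    IsUnitAt x (baseToFunctionField π a) ↔ a ∉ (π.base x).asIdeal := by
  have e : toFunctionField x (X.presheaf.germ ⊤ x trivial
      (Literature.AlgebraicGeometry.Morphisms.algebraMapΓ π a)) = baseToFunctionField π a :=
    RatFn.toFunctionField_germ (Set.mem_univ x) _
  rw [← e, isUnitAt_germ_iff]
  have hb : X.basicOpen (Literature.AlgebraicGeometry.Morphisms.algebraMapΓ π a) =
      π ⁻¹ᵁ ((Spec (.of T)).basicOpen ((Scheme.ΓSpecIso (.of T)).inv a)) := by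
    rw [Scheme.preimage_basicOpen_top]
    rfl
  rw [hb, basicOpen_eq_of_affine]
  change π.base x ∈ PrimeSpectrum.basicOpen a ↔ _
  exact PrimeSpectrum.mem_basicOpen a (π.base x)

omit [IsIntegral X] in
/-- A proper dominant morphism to `Spec T` is surjective (closed dense image). [folklore] -/
theorem surjective_base_of_isProper [IsProper π] [IsDominant π] : Function.Surjective π.base := by
  rw [← Set.range_eq_univ, ← π.isClosedMap.isClosed_range.closure_eq]
  exact π.denseRange.closure_eq

end Base

/-! ## §2 The theorem -/

section Main

variable {T : Type u} [CommRing T] [IsDomain T] [IsNoetherianRing T] [IsLocalRing T] [IsIntegrallyClosed T]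
  {X : Scheme.{u}} [IsIntegral X] [IsLocallyNoetherian X] {π : X ⟶ Spec (.of T)}

/-- **UP-1′: an effective exceptional Cartier divisor meets some exceptional curve non-trivially.**  For
`T` a Noetherian local normal domain of Krull dimension `≥ 2`, `π : X → Spec T` a resolution with fibres of
dimension `≤ 1` and `H¹(X, 𝒪_X) = 0`, and `D ≥ 0` a Cartier divisor on `X` whose local equations are units off
the closed fibre and a non-unit at some point: granting Lipman (12.1) (i), `(𝒪_X(D) · E_η) ≠ 0` for some
integral exceptional curve `E_η`.  (The (B1) split core applies it on `X¹ → Spec D_f` to the cycle `Z` with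
`I · 𝒪_(X¹) = 𝒪(−Z)`: the set of curves with `(Z·E) < 0` is non-empty.)
[cite: Lipman1969, Theorem (12.1) (i) (p. 220)] -/
theorem exists_excCurveDegree_ne_zero (h121 : Lipman1969_12_1_i.{u}) (hdim : 2 ≤ ringKrullDim T)
    (hπ : IsResolution π) (hfib : ∀ y : Spec (.of T), topologicalKrullDim (π.fiber y) ≤ 1)
    (hH1 : HasTrivialCechH1 π) (D : CartierDivisor X) (hD : D.IsEffective)
    (hoff : ∀ (i : D.ι) (x : X), x ∈ D.U i → π.base x ≠ closedPoint T → IsUnitAt x (D.f i))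
    (hx₀ : ∃ (i : D.ι) (x₀ : X), x₀ ∈ D.U i ∧ ¬ IsUnitAt x₀ (D.f i)) :
    ∃ η ∈ excCurvePoints π, excCurveDegree π D η ≠ 0 := by
  haveI : IsProper π := hπ.isProper
  haveI : IsDominant π := hπ.isBirational.isDominant
  by_contra! H
  obtain ⟨s, -, hnv⟩ := (h121 T X π hfib hH1 D).mp H
  obtain ⟨i₀, x₀, hx₀U, hx₀⟩ := hx₀
  -- `f_i · s` is a unit on `U_i`
  have hu : ∀ (i : D.ι) (x : X), x ∈ D.U i → IsUnitAt x (D.f i * s) :=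
    fun i x hi => (D.mem_nonvanishing_iff hi).mp (hnv x)
  have hs0 : s ≠ 0 := by
    intro h
    have := (hu i₀ x₀ hx₀U).ne_zero
    rw [h, mul_zero] at this
    exact this rfl
  set t : X.functionField := s⁻¹ with ht
  have hft : ∀ i : D.ι, D.f i * (D.f i * s)⁻¹ = t := fun i => by
    rw [ht, mul_inv, ← mul_assoc, mul_inv_cancel₀ (D.f_ne_zero i), one_mul]
  -- `t` is regular everywhere, a unit off the closed fibre, not a unit at `x₀`
  have hreg : ∀ x : X, IsRegularAt x t := fun x => by
    obtain ⟨i, hi⟩ := D.covers x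
    rw [← hft i]
    exact (hD i x hi).mul (hu i x hi).inv.isRegularAt
  have hunit : ∀ x : X, π.base x ≠ closedPoint T → IsUnitAt x t := fun x hx => by
    obtain ⟨i, hi⟩ := D.covers x
    rw [← hft i]
    exact (hoff i x hi hx).mul (hu i x hi).inv
  have hx₀t : ¬ IsUnitAt x₀ t := fun h => hx₀ (by
    have h' := h.mul (hu i₀ x₀ hx₀U)
    rwa [ht, mul_comm, mul_assoc, mul_inv_cancel₀ hs0, mul_one] at h')
  -- `t ∈ T`
  obtain ⟨a, ha⟩ := hπ.exists_baseToFunctionField_eq_of_forall_isRegularAt π t hreg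
  -- `a ∈ 𝔪_T`
  have ham : a ∈ maximalIdeal T := by
    have h1 : ¬ (a ∉ (π.base x₀).asIdeal) := fun hna =>
      hx₀t (ha ▸ (isUnitAt_baseToFunctionField_iff π x₀ a).mpr hna)
    push Not at h1
    exact IsLocalRing.le_maximalIdeal (π.base x₀).2.ne_top h1
  -- `a ∈ 𝔭 ≠ 𝔪`
  obtain ⟨𝔭, h𝔭, ha𝔭, h𝔭ne⟩ := exists_prime_mem_ne_maximalIdeal hdim ham
  -- a point `x₁` over `𝔭`
  obtain ⟨x₁, hx₁⟩ := surjective_base_of_isProper π ⟨𝔭, h𝔭⟩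
  have hoff₁ : π.base x₁ ≠ closedPoint T := by
    rw [hx₁]
    intro h
    exact h𝔭ne (congrArg PrimeSpectrum.asIdeal h)
  have hu₁ : IsUnitAt x₁ (baseToFunctionField π a) := ha ▸ hunit x₁ hoff₁
  rw [isUnitAt_baseToFunctionField_iff π x₁ a, hx₁] at hu₁
  exact hu₁ ha𝔭

/-- **Anti-nef sign form (STEP 3 (1) of the (B1) split core: `P ≠ ∅`).**  Under the hypotheses of
`exists_excCurveDegree_ne_zero`, if moreover `(𝒪_X(D) · E) ≤ 0` for every integral exceptional curve (the
cycle is anti-nef), then `(𝒪_X(D) · E_η) < 0` for some `η`. [cite: Lipman1969, Theorem (12.1) (i) (p. 220)] -/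
theorem exists_excCurveDegree_neg_of_antinef (h121 : Lipman1969_12_1_i.{u}) (hdim : 2 ≤ ringKrullDim T)
    (hπ : IsResolution π) (hfib : ∀ y : Spec (.of T), topologicalKrullDim (π.fiber y) ≤ 1)
    (hH1 : HasTrivialCechH1 π) (D : CartierDivisor X) (hD : D.IsEffective)
    (hoff : ∀ (i : D.ι) (x : X), x ∈ D.U i → π.base x ≠ closedPoint T → IsUnitAt x (D.f i))
    (hx₀ : ∃ (i : D.ι) (x₀ : X), x₀ ∈ D.U i ∧ ¬ IsUnitAt x₀ (D.f i))
    (hanti : ∀ η ∈ excCurvePoints π, excCurveDegree π D η ≤ 0) :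
    ∃ η ∈ excCurvePoints π, excCurveDegree π D η < 0 := by
  obtain ⟨η, hη, hne⟩ := exists_excCurveDegree_ne_zero h121 hdim hπ hfib hH1 D hD hoff hx₀
  exact ⟨η, hη, lt_of_le_of_ne (hanti η hη) hne⟩

/-- **The surface case** (`dim T = 2`): the fibre hypothesis is discharged by the tree's
`IsResolution.topologicalKrullDim_fiber_le_one`. [cite: Lipman1969, Theorem (12.1) (i) (p. 220)] -/
theorem exists_excCurveDegree_ne_zero_of_ringKrullDim_eq_two (h121 : Lipman1969_12_1_i.{u})
    (hdim : ringKrullDim T = 2) (hπ : IsResolution π) (hH1 : HasTrivialCechH1 π)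
    (D : CartierDivisor X) (hD : D.IsEffective)
    (hoff : ∀ (i : D.ι) (x : X), x ∈ D.U i → π.base x ≠ closedPoint T → IsUnitAt x (D.f i))
    (hx₀ : ∃ (i : D.ι) (x₀ : X), x₀ ∈ D.U i ∧ ¬ IsUnitAt x₀ (D.f i)) :
    ∃ η ∈ excCurvePoints π, excCurveDegree π D η ≠ 0 :=
  exists_excCurveDegree_ne_zero h121 hdim.symm.le hπ
    (hπ.topologicalKrullDim_fiber_le_one hdim.le) hH1 D hD hoff hx₀

/-- **The surface case, anti-nef sign form.** [cite: Lipman1969, Theorem (12.1) (i) (p. 220)] -/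
theorem exists_excCurveDegree_neg_of_antinef_of_ringKrullDim_eq_two (h121 : Lipman1969_12_1_i.{u})
    (hdim : ringKrullDim T = 2) (hπ : IsResolution π) (hH1 : HasTrivialCechH1 π)
    (D : CartierDivisor X) (hD : D.IsEffective)
    (hoff : ∀ (i : D.ι) (x : X), x ∈ D.U i → π.base x ≠ closedPoint T → IsUnitAt x (D.f i))
    (hx₀ : ∃ (i : D.ι) (x₀ : X), x₀ ∈ D.U i ∧ ¬ IsUnitAt x₀ (D.f i))
    (hanti : ∀ η ∈ excCurvePoints π, excCurveDegree π D η ≤ 0) :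
    ∃ η ∈ excCurvePoints π, excCurveDegree π D η < 0 :=
  exists_excCurveDegree_neg_of_antinef h121 hdim.symm.le hπ
    (hπ.topologicalKrullDim_fiber_le_one hdim.le) hH1 D hD hoff hx₀ hanti

/-! ## §3 Support form: `Supp D` inside the closed fibre and non-empty -/

/-- **UP-1′ in support language**: for `D ≥ 0` with `Supp D` contained in the closed fibre (`D.Avoids x` off
it) and non-empty, some `(𝒪_X(D) · E_η) ≠ 0`. [cite: Lipman1969, Theorem (12.1) (i) (p. 220)] -/
theorem exists_excCurveDegree_ne_zero_of_supp (h121 : Lipman1969_12_1_i.{u}) (hdim : 2 ≤ ringKrullDim T)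
    (hπ : IsResolution π) (hfib : ∀ y : Spec (.of T), topologicalKrullDim (π.fiber y) ≤ 1)
    (hH1 : HasTrivialCechH1 π) (D : CartierDivisor X) (hD : D.IsEffective)
    (hoff : ∀ x : X, π.base x ≠ closedPoint T → D.Avoids x) (hx₀ : ∃ x₀ : X, ¬ D.Avoids x₀) :
    ∃ η ∈ excCurvePoints π, excCurveDegree π D η ≠ 0 := by
  refine exists_excCurveDegree_ne_zero h121 hdim hπ hfib hH1 D hD (fun i x hi hx => hoff x hx i hi) ?_
  obtain ⟨x₀, hx₀⟩ := hx₀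
  obtain ⟨i, hi⟩ := D.covers x₀
  exact ⟨i, x₀, hi, fun h => hx₀ (CartierDivisor.Avoids.of_mem hi h)⟩

/-- **Support language, anti-nef sign form, surface case** — the shape consumed by STEP 3 (1) of the (B1)
split core: on a resolution `X¹ → Spec D_f` of a two-dimensional normal germ with `H¹ = 0`, an effective
divisor `Z ≠ 0` supported on the closed fibre with all `(Z·E) ≤ 0` has some `(Z·E) < 0`.
[cite: Lipman1969, Theorem (12.1) (i) (p. 220)] -/
theorem exists_excCurveDegree_neg_of_supp_of_ringKrullDim_eq_two (h121 : Lipman1969_12_1_i.{u})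
    (hdim : ringKrullDim T = 2) (hπ : IsResolution π) (hH1 : HasTrivialCechH1 π)
    (D : CartierDivisor X) (hD : D.IsEffective)
    (hoff : ∀ x : X, π.base x ≠ closedPoint T → D.Avoids x) (hx₀ : ∃ x₀ : X, ¬ D.Avoids x₀)
    (hanti : ∀ η ∈ excCurvePoints π, excCurveDegree π D η ≤ 0) :
    ∃ η ∈ excCurvePoints π, excCurveDegree π D η < 0 := by
  obtain ⟨η, hη, hne⟩ := exists_excCurveDegree_ne_zero_of_supp h121 hdim.symm.le hπ
    (hπ.topologicalKrullDim_fiber_le_one hdim.le) hH1 D hD hoff hx₀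
  exact ⟨η, hη, lt_of_le_of_ne (hanti η hη) hne⟩

end Main

end Summit.ResolutionOfSingularities.ResolutionOfSingularities.Theorems.NoZeno.ExcCount

end
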